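import Mathlib
import HarnessLib
import Literature.Analysis.FluidPDE.SelfSimilar
import Literature.Analysis.FluidPDE.LocalTypeI
import Literature.Analysis.FluidPDE.VectorCalculus
import Literature.Analysis.FluidPDE.VanishingVerticalVorticityPotentials
import Literature.Analysis.FluidPDE.VanishingVerticalVorticityPotentialsTime
import Literature.Analysis.FluidPDE.TaoEnstrophyLocalisation
import Literature.Analysis.UnboundedOperators.HeatKernel
import Summits.NavierStokesRegularity.NavierStokesRegularity.Theorems.LocalSineTubeDoorProfileAlignedWindowRigidityAncient
import Summits.NavierStokesRegularity.NavierStokesRegularity.Theorems.PoloidalWindowDoorPoloidalWindowRigidityClebsch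
import Summits.NavierStokesRegularity.NavierStokesRegularity.Theorems.PoloidalWindowDoorPoloidalWindowRigidityClassRate
import Summits.NavierStokesRegularity.NavierStokesRegularity.Theorems.PoloidalWindowDoorPoloidalWindowRigidityScrewKinematics

/-!
# Route `PoloidalWindowDoor`, crux `PoloidalWindowRigidity` (K2, stmt-NavierStokesRegularity-19708) — the Clebsch stream
# function in the AXIS GAUGE has DECAYING SLOPE: `|ψ(t,x) − ψ(t,0)| ≤ C₃‖x‖/(−t)` (CENSUS-K2G §12.2, §14.1 Steps 1–2)

Cell ns-regularity-ideate, K2 lead nsreg-p7 (support file, `--supports stmt-…-19708 --as helper`; input of the planned stratum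
«source of ψ gaugeable to a function of t ⇒ trivial», CENSUS §12 Cor. A, via the landed decaying-slope Liouville lemma
`…DecayingSlopeLiouville.stub_decayingSlopeLiouville`).  For a profile of the route's Type-I class, poloidal along `e₃`:

* `exists_clebsch_uncurry_axis` — the time-dependent Clebsch pair of `…Clebsch.exists_clebsch_uncurry` RE-EXPORTED WITH THE
  AXIS NORMALISATION `φ(t, c e₃) = 0` (the horizontal line potential vanishes on the vertical axis), hence
  `∂₃φ(t,·) = 0` on the axis and `ψ(t, c e₃) = v₃(t, c e₃)`;
* `exists_clebsch_uncurry_slope` — consequently, with the class rates `‖Dv(t)‖ ≤ C₁/(−t)`, `‖curl v(t)‖ ≤ C₂/(−t)`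
  (`…ClassRate`), **`|ψ(t,x) − ψ(t,0)| ≤ (C₁ + C₂)‖x‖/(−t)`** for all `t < 0`, `x` (horizontal mean value with
  `∇_hψ = (−ω₁, ω₀)`, tree `…ScrewKinematics.abs_horizontal_pairing_le`; vertical mean value of `v₃` along the axis).
  This is exactly the «decaying slope» hypothesis of the Liouville lemma (`ε(t) = (C₁+C₂)/(−t)`, `ε√(−t) → 0`).

WHAT THIS IS NOT: not a claim about Navier–Stokes regularity — kinematics of the registered class (bears_on LADDER-NS N0,
rung N0-LocalTubeDoorPoloidal).
-/

noncomputable section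

-- the summit and its single sub-problem share the name (CONVENTIONS §1), as in every Theorems file
set_option linter.dupNamespace false

namespace Summit.NavierStokesRegularity.NavierStokesRegularity.Theorems.PoloidalWindowDoorPoloidalWindowRigidityClebschSlope

open MeasureTheory Set Function Filter Topology TopologicalSpace Metric
open scoped RealInnerProductSpace InnerProductSpace Laplacian ContDiff
open Literature.Analysis Literature.Analysis.FluidPDE
open Literature.Analysis.FluidPDE.VerticalVorticityFree
open Summit.NavierStokesRegularity.NavierStokesRegularity.Theorems.LocalSineTubeDoorProfileAlignedWindowRigidityAncient
open Summit.NavierStokesRegularity.NavierStokesRegularity.Theorems.PoloidalWindowDoorPoloidalWindowRigidityClebsch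
open Summit.NavierStokesRegularity.NavierStokesRegularity.Theorems.PoloidalWindowDoorPoloidalWindowRigidityClassRate
open Summit.NavierStokesRegularity.NavierStokesRegularity.Theorems.PoloidalWindowDoorPoloidalWindowRigidityScrewKinematics

variable {C : ℝ} {v : ℝ → EuclideanSpace ℝ (Fin 3) → EuclideanSpace ℝ (Fin 3)}

/-- `|x i| ≤ ‖x‖` in `ℝ³`. -/
theorem abs_apply_le_norm₃ (x : EuclideanSpace ℝ (Fin 3)) (i : Fin 3) : |x i| ≤ ‖x‖ := by
  rw [← Real.sqrt_sq_eq_abs, EuclideanSpace.norm_eq]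
  refine Real.sqrt_le_sqrt ?_
  have h := Finset.single_le_sum (f := fun j : Fin 3 => ‖x j‖ ^ 2) (fun j _ => by positivity) (Finset.mem_univ i)
  simpa [Real.norm_eq_abs, sq_abs] using h

/-- `‖x₀ e₀ + x₁ e₁‖ ≤ ‖x‖` (the horizontal part is shorter). -/
theorem norm_horizontal_le (x : EuclideanSpace ℝ (Fin 3)) :
    ‖x 0 • (EuclideanSpace.single 0 (1 : ℝ) : EuclideanSpace ℝ (Fin 3)) +
      x 1 • (EuclideanSpace.single 1 (1 : ℝ) : EuclideanSpace ℝ (Fin 3))‖ ≤ ‖x‖ := by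
  rw [EuclideanSpace.norm_eq, EuclideanSpace.norm_eq]
  refine Real.sqrt_le_sqrt ?_
  simp [Fin.sum_univ_three, Real.norm_eq_abs, sq_abs]
  positivity

/-- **Time-dependent Clebsch potentials with the axis normalisation.**  As `…Clebsch.exists_clebsch_uncurry`, plus
`φ(t, c e₃) = 0` for all `c` (the line potential vanishes on the vertical axis). -/
theorem exists_clebsch_uncurry_axis (hrate : HasTypeITimeDecay C v)
    (hcont : ContinuousOn (uncurry v) (Iio (0 : ℝ) ×ˢ univ))
    (hmild : ∀ s t : ℝ, s < t → t < 0 → ∀ x,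
      v t x = UnboundedOperators.heatExtension (v s) (t - s) x - oseenDuhamel 1 s v v t x)
    (hpol : ∀ s < 0, ∀ y, ⟪curl (v s) y, EuclideanSpace.single 2 1⟫_ℝ = 0) :
    ∃ φ ψ : ℝ → EuclideanSpace ℝ (Fin 3) → ℝ,
      ContDiffOn ℝ ∞ (uncurry φ) (Iio (0 : ℝ) ×ˢ univ) ∧ ContDiffOn ℝ ∞ (uncurry ψ) (Iio (0 : ℝ) ×ˢ univ) ∧
      ∀ t < 0,
        (∀ y, v t y 2 = fderiv ℝ (φ t) y (EuclideanSpace.single 2 1) + ψ t y) ∧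
        (∀ y, curl (v t) y 0 = fderiv ℝ (ψ t) y (EuclideanSpace.single 1 1) ∧
          curl (v t) y 1 = -fderiv ℝ (ψ t) y (EuclideanSpace.single 0 1) ∧ curl (v t) y 2 = 0) ∧
        (∀ c : ℝ, φ t (c • EuclideanSpace.single 2 (1 : ℝ)) = 0) := by
  have hsm : ContDiffOn ℝ ∞ (uncurry v) (Iio (0 : ℝ) ×ˢ univ) :=
    (analyticOnNhd_uncurry hcont (bdd_of_hasTypeITimeDecay hrate) hmild).contDiffOn_of_completeSpace
  set φ : ℝ → EuclideanSpace ℝ (Fin 3) → ℝ := fun t x =>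
    ∫ σ in (0 : ℝ)..1, ⟪v t (σ • (x - x 2 • (EuclideanSpace.single (2 : Fin 3) (1 : ℝ))) +
      x 2 • (EuclideanSpace.single (2 : Fin 3) (1 : ℝ))),
      x - x 2 • (EuclideanSpace.single (2 : Fin 3) (1 : ℝ))⟫_ℝ with hφ
  set ψ : ℝ → EuclideanSpace ℝ (Fin 3) → ℝ := fun t y =>
    v t y 2 - fderiv ℝ (φ t) y (EuclideanSpace.single 2 1) with hψ
  have hφs : ContDiffOn ℝ ∞ (uncurry φ) (Iio (0 : ℝ) ×ˢ univ) := contDiffOn_linePotential_uncurry hsm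
  have hDφ : IsSmoothSpaceTimeOn (Iio (0 : ℝ)) (fun t x => fderiv ℝ (φ t) x) :=
    IsSmoothSpaceTimeOn.fderiv_slice hφs (isOpen_Iio.uniqueDiffOn)
  have hψs : ContDiffOn ℝ ∞ (uncurry ψ) (Iio (0 : ℝ) ×ˢ univ) := by
    have h1 : ContDiffOn ℝ ∞ (fun q : ℝ × EuclideanSpace ℝ (Fin 3) => (uncurry v) q 2) (Iio (0 : ℝ) ×ˢ univ) :=
      (EuclideanSpace.proj (2 : Fin 3) : EuclideanSpace ℝ (Fin 3) →L[ℝ] ℝ).contDiff.comp_contDiffOn hsm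
    have h2 : ContDiffOn ℝ ∞ (fun q : ℝ × EuclideanSpace ℝ (Fin 3) =>
        (uncurry (fun t x => fderiv ℝ (φ t) x)) q (EuclideanSpace.single 2 1)) (Iio (0 : ℝ) ×ˢ univ) :=
      ContDiffOn.clm_apply (show ContDiffOn ℝ ∞ (uncurry fun t x => fderiv ℝ (φ t) x)
        (Iio (0 : ℝ) ×ˢ univ) from hDφ) contDiffOn_const
    exact (h1.sub h2).congr fun q _ => by rcases q with ⟨t, y⟩; rfl
  refine ⟨φ, ψ, hφs, hψs, fun t ht => ?_⟩
  have hV : ContDiff ℝ ∞ (v t) := contDiff_slice hrate hcont hmild ht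
  have hc2 : ∀ y, curl (v t) y 2 = 0 := fun y => curl_two_eq_zero hpol ht y
  have hφt : φ t = fun x : EuclideanSpace ℝ (Fin 3) =>
      ∫ σ in (0 : ℝ)..1, ⟪v t (σ • (x - x 2 • (EuclideanSpace.single (2 : Fin 3) (1 : ℝ))) +
        x 2 • (EuclideanSpace.single (2 : Fin 3) (1 : ℝ))),
        x - x 2 • (EuclideanSpace.single (2 : Fin 3) (1 : ℝ))⟫_ℝ := rfl
  have h2 : ∀ y, v t y 2 = fderiv ℝ (φ t) y (EuclideanSpace.single 2 1) + ψ t y := fun y => by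
    simp only [hψ]; ring
  have hcomp : ∀ y, curl (v t) y 0 = fderiv ℝ (ψ t) y (EuclideanSpace.single 1 1) ∧
      curl (v t) y 1 = -fderiv ℝ (ψ t) y (EuclideanSpace.single 0 1) ∧ curl (v t) y 2 = 0 :=
    fun y => curl_apply_eq_fderiv_stream hV hc2 hφt y
  have haxis : ∀ c : ℝ, φ t (c • EuclideanSpace.single 2 (1 : ℝ)) = 0 := by
    intro c
    have hx : (c • (EuclideanSpace.single (2 : Fin 3) (1 : ℝ) : EuclideanSpace ℝ (Fin 3))) 2 = c := by simp
    have hz : c • (EuclideanSpace.single (2 : Fin 3) (1 : ℝ) : EuclideanSpace ℝ (Fin 3)) -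
        (c • (EuclideanSpace.single (2 : Fin 3) (1 : ℝ) : EuclideanSpace ℝ (Fin 3))) 2 •
          (EuclideanSpace.single (2 : Fin 3) (1 : ℝ)) = 0 := by
      rw [hx, sub_self]
    show (∫ σ in (0 : ℝ)..1, _) = 0
    simp only [hz, inner_zero_right, intervalIntegral.integral_zero]
  exact ⟨h2, hcomp, haxis⟩

/-- **THE DECAYING SLOPE OF THE CLEBSCH STREAM FUNCTION.**  For a profile of the route's Type-I class, poloidal along
`e₃`, there are the axis-gauge Clebsch potentials (jointly smooth, `v₃ = ∂₃φ + ψ`, `curl v ↔ ∇ψ`, `φ = 0` on the axis)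
AND a constant `C₃` with `|ψ(t,x) − ψ(t,0)| ≤ C₃‖x‖/(−t)` for all `t < 0`, `x`. -/
theorem exists_clebsch_uncurry_slope (hrate : HasTypeITimeDecay C v)
    (hcont : ContinuousOn (uncurry v) (Iio (0 : ℝ) ×ˢ univ))
    (hmild : ∀ s t : ℝ, s < t → t < 0 → ∀ x,
      v t x = UnboundedOperators.heatExtension (v s) (t - s) x - oseenDuhamel 1 s v v t x)
    (hpol : ∀ s < 0, ∀ y, ⟪curl (v s) y, EuclideanSpace.single 2 1⟫_ℝ = 0) :
    ∃ φ ψ : ℝ → EuclideanSpace ℝ (Fin 3) → ℝ,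
      ContDiffOn ℝ ∞ (uncurry φ) (Iio (0 : ℝ) ×ˢ univ) ∧ ContDiffOn ℝ ∞ (uncurry ψ) (Iio (0 : ℝ) ×ˢ univ) ∧
      (∀ t < 0,
        (∀ y, v t y 2 = fderiv ℝ (φ t) y (EuclideanSpace.single 2 1) + ψ t y) ∧
        (∀ y, curl (v t) y 0 = fderiv ℝ (ψ t) y (EuclideanSpace.single 1 1) ∧
          curl (v t) y 1 = -fderiv ℝ (ψ t) y (EuclideanSpace.single 0 1) ∧ curl (v t) y 2 = 0) ∧
        (∀ c : ℝ, φ t (c • EuclideanSpace.single 2 (1 : ℝ)) = 0)) ∧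
      ∃ C₃ : ℝ, ∀ t < 0, ∀ x, |ψ t x - ψ t 0| ≤ C₃ / (-t) * ‖x‖ := by
  obtain ⟨φ, ψ, hφs, hψs, hprop⟩ := exists_clebsch_uncurry_axis hrate hcont hmild hpol
  obtain ⟨C₁, hC₁⟩ := exists_fderiv_rate_of_class hrate hcont hmild
  obtain ⟨C₂, hC₂⟩ := exists_curl_rate_of_class hrate hcont hmild
  refine ⟨φ, ψ, hφs, hψs, hprop, C₁ + C₂, fun t ht x => ?_⟩
  obtain ⟨h2, hcomp, haxis⟩ := hprop t ht
  have hnt : 0 < -t := neg_pos.2 ht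
  have hV : ContDiff ℝ ∞ (v t) := contDiff_slice hrate hcont hmild ht
  have hφd : Differentiable ℝ (φ t) :=
    (contDiff_infty.1 (IsSmoothSpaceTimeOn.contDiff_slice hφs ht) 1).differentiable one_ne_zero
  have hψd : Differentiable ℝ (ψ t) :=
    (contDiff_infty.1 (IsSmoothSpaceTimeOn.contDiff_slice hψs ht) 1).differentiable one_ne_zero
  have hvd : Differentiable ℝ (v t) := (contDiff_infty.1 hV 1).differentiable one_ne_zero
  -- nonnegativity of the rates
  have hC₁0 : 0 ≤ C₁ / (-t) := le_trans (norm_nonneg _) (hC₁ t ht 0)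
  have hC₂0 : 0 ≤ C₂ / (-t) := le_trans (norm_nonneg _) (hC₂ t ht 0)
  -- ## the axis: `∂₃φ(t, c e₃) = 0`, hence `ψ = v₃` there
  set e₃ : EuclideanSpace ℝ (Fin 3) := EuclideanSpace.single 2 (1 : ℝ) with he₃
  have hax_d : ∀ c : ℝ, fderiv ℝ (φ t) (c • e₃) e₃ = 0 := by
    intro c
    have hg : HasDerivAt (fun s : ℝ => φ t (s • e₃)) (fderiv ℝ (φ t) (c • e₃) e₃) c := by
      have hl : HasDerivAt (fun s : ℝ => s • e₃) e₃ c := by simpa using (hasDerivAt_id c).smul_const e₃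
      exact (hφd (c • e₃)).hasFDerivAt.comp_hasDerivAt c hl
    have hzero : (fun s : ℝ => φ t (s • e₃)) = fun _ => 0 := funext fun s => haxis s
    rw [hzero] at hg
    exact (hg.unique (hasDerivAt_const c (0:ℝ))).symm ▸ rfl
  have hax_ψ : ∀ c : ℝ, ψ t (c • e₃) = v t (c • e₃) 2 := by
    intro c
    have := h2 (c • e₃)
    rw [hax_d c, zero_add] at this
    exact this.symm
  -- ## vertical step along the axis: `|v₃(t, z e₃) − v₃(t, 0)| ≤ (C₁/(−t)) |z|`
  have hvert : |ψ t (x 2 • e₃) - ψ t 0| ≤ C₁ / (-t) * ‖x‖ := by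
    rw [hax_ψ (x 2), show (0 : EuclideanSpace ℝ (Fin 3)) = (0:ℝ) • e₃ by simp, hax_ψ 0]
    -- mean value for `s ↦ v t (s e₃) 2` on `[0, x 2]`
    have hder : ∀ s : ℝ, HasDerivAt (fun s : ℝ => v t (s • e₃) 2) (fderiv ℝ (v t) (s • e₃) e₃ 2) s := by
      intro s
      have hl : HasDerivAt (fun s : ℝ => s • e₃) e₃ s := by simpa using (hasDerivAt_id s).smul_const e₃
      have h1 := (hvd (s • e₃)).hasFDerivAt.comp_hasDerivAt s hl
      exact (EuclideanSpace.proj (2 : Fin 3) : EuclideanSpace ℝ (Fin 3) →L[ℝ] ℝ).hasFDerivAt.comp_hasDerivAt s h1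
    have hbd : ∀ s : ℝ, ‖fderiv ℝ (v t) (s • e₃) e₃ 2‖ ≤ C₁ / (-t) := by
      intro s
      refine (Real.norm_eq_abs _ ▸ abs_apply_le_norm₃ _ 2).trans ?_
      refine (ContinuousLinearMap.le_opNorm _ _).trans ?_
      rw [he₃, PiLp.norm_single, norm_one, mul_one]
      exact hC₁ t ht _
    have hmvt := Convex.norm_image_sub_le_of_norm_hasDerivWithin_le (f := fun s : ℝ => v t (s • e₃) 2)
      (fun s _ => (hder s).hasDerivWithinAt) (fun s _ => hbd s) convex_univ (mem_univ (0:ℝ)) (mem_univ (x 2))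
    rw [Real.norm_eq_abs, Real.norm_eq_abs, sub_zero] at hmvt
    simp only [zero_smul] at hmvt ⊢
    exact hmvt.trans (mul_le_mul_of_nonneg_left (abs_apply_le_norm₃ x 2) hC₁0)
  -- ## horizontal step in the plane of `x`: `|ψ(t,x) − ψ(t, x₃e₃)| ≤ (C₂/(−t)) ‖x_h‖`
  set xh : EuclideanSpace ℝ (Fin 3) := x 0 • (EuclideanSpace.single 0 (1 : ℝ) : EuclideanSpace ℝ (Fin 3)) +
    x 1 • (EuclideanSpace.single 1 (1 : ℝ) : EuclideanSpace ℝ (Fin 3)) with hxh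
  have hx_dec : x = x 2 • e₃ + xh := by
    ext i; fin_cases i <;> simp [hxh, he₃]
  have hhor : |ψ t x - ψ t (x 2 • e₃)| ≤ C₂ / (-t) * ‖x‖ := by
    have hder : ∀ s : ℝ, HasDerivAt (fun s : ℝ => ψ t (x 2 • e₃ + s • xh))
        (fderiv ℝ (ψ t) (x 2 • e₃ + s • xh) xh) s := by
      intro s
      have hl : HasDerivAt (fun s : ℝ => x 2 • e₃ + s • xh) xh s := by
        simpa using ((hasDerivAt_id s).smul_const xh).const_add (x 2 • e₃)
      exact (hψd _).hasFDerivAt.comp_hasDerivAt s hl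
    have hbd : ∀ s : ℝ, ‖fderiv ℝ (ψ t) (x 2 • e₃ + s • xh) xh‖ ≤ C₂ / (-t) * ‖xh‖ := by
      intro s
      set z := x 2 • e₃ + s • xh
      obtain ⟨hc0, hc1, -⟩ := hcomp z
      have hlin : fderiv ℝ (ψ t) z xh = x 0 * (-(curl (v t) z 1)) + x 1 * curl (v t) z 0 := by
        rw [hxh, map_add, map_smul, map_smul, smul_eq_mul, smul_eq_mul, hc0, hc1]; ring
      rw [hlin, Real.norm_eq_abs]
      refine (abs_horizontal_pairing_le (x 0) (x 1) (curl (v t) z)).trans ?_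
      rw [← hxh, mul_comm]
      exact mul_le_mul_of_nonneg_right (hC₂ t ht z) (norm_nonneg _)
    have hmvt := Convex.norm_image_sub_le_of_norm_hasDerivWithin_le (f := fun s : ℝ => ψ t (x 2 • e₃ + s • xh))
      (fun s _ => (hder s).hasDerivWithinAt) (fun s _ => hbd s) convex_univ (mem_univ (0:ℝ)) (mem_univ (1:ℝ))
    simp only [one_smul, zero_smul, add_zero, Real.norm_eq_abs, sub_zero, abs_one, mul_one] at hmvt
    rw [← hx_dec] at hmvt
    exact hmvt.trans (mul_le_mul_of_nonneg_left (norm_horizontal_le x) hC₂0)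
  -- ## together
  have htri : |ψ t x - ψ t 0| ≤ |ψ t x - ψ t (x 2 • e₃)| + |ψ t (x 2 • e₃) - ψ t 0| := abs_sub_le _ _ _
  calc |ψ t x - ψ t 0| ≤ C₂ / (-t) * ‖x‖ + C₁ / (-t) * ‖x‖ := htri.trans (add_le_add hhor hvert)
    _ = (C₁ + C₂) / (-t) * ‖x‖ := by ring

end Summit.NavierStokesRegularity.NavierStokesRegularity.Theorems.PoloidalWindowDoorPoloidalWindowRigidityClebschSlope

end
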